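import Summits.ValiantsHypothesis.ValiantsHypothesis.Theorems.KPlusLogSqLawRealStaticNormalForm
import Summits.ValiantsHypothesis.ValiantsHypothesis.Theorems.LacunarySymmetroidMatrixDescartesCensusTropicalKLawStatic
import Summits.ValiantsHypothesis.ValiantsHypothesis.Theorems.KPlusLogSqLawWeakLiftingBridge
import Summits.ValiantsHypothesis.ValiantsHypothesis.Theorems.LacunarySymmetroidMatrixDescartesCensusKLawBridge
import Summits.ValiantsHypothesis.ValiantsHypothesis.Theorems.LacunarySymmetroidAssembly
import Summits.ValiantsHypothesis.ValiantsHypothesis.Theorems.LacunarySymmetroidPencilTransfer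
import Summits.ValiantsHypothesis.ValiantsHypothesis.Theorems.LacunarySymmetroidThetaWitness

/-!
# Route «KPlusLogSqLaw» — the STATIC WEAK LIFTING statement: the lifting crux may assume static letters on BOTH sides

HONEST FRAMING.  Helper bookkeeping for the OPEN crux `WeakLifting` (stmt-ValiantsHypothesis-19561, route `KPlusLogSqLaw`, cell
`pub-symmetroid`; seat val-sym-lift-p4 g25, 2026-08-29).  It states — INLINE, as an unnamed hypothesis shape, never asserted — the
STATIC form `W_static` of the weak lifting statement and proves how it sits among the route's statements.  Nothing here asserts
`WeakLifting`, `W_static`, `TropicalB`/`TropKPlusLogSqLaw`, Conjecture B (`KPlusLogSqLaw`), `MatrixDescartes` (stmt-ValiantsHypothesis-18050)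
or VP ≠ VNP: every theorem is an implication / equivalence between OPEN statements, or a transfer with an open hypothesis.

`W_static` («static weak LIFT»):  `∃ C, ∀ m K n,  TropRootLawAtStatic m K n →` every STATIC SYMMETRIC real pencil of format `(m, K)`
(every entry a single signed monomial: `E l₁ x y ≠ 0 → E l₂ x y ≠ 0 → l₁ = l₂`) has at most `2^(C (K + ⌊log₂ m⌋²))·(n + 1)` distinct real
zeros of its determinant.  Both sides now speak about the SAME objects: monomial-entry symmetric matrices `(c_{ij} X^{e_{ij}})` with the
`e_{ij}` from `K` values — on the tropical side the sign-alternating breakpoints of the LINEAR parametric assignment instance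
`(e_{ij}·θ − v_{ij})` (`TropicalCensus.TropRootLawAtStatic`), on the real side the real zeros of the signed matching polynomial
`det = ∑_σ sign σ · c_σ · X^{w(σ)}`.

CONTENT (all proved).
* `weakLiftingStatic_of_kPlusLogSqLaw` — B ⇒ W_static (no tropical input, as for W: `TropicalCensus.weakLifting_of_kPlusLogSqLaw`);
* `weakLiftingStatic_of_weakLifting` — **W ⇒ W_static UNCONDITIONALLY** (the tropical static reduction
  `TropicalCensus.tropRootLawAt_of_static`: `T + 1 ≤ (m²(K−1)+1)(T_static + 1)`, and `m²(K−1)+1 ≤ 2^(3(K + ⌊log₂ m⌋²) + 2)`);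
* `kPlusLogSqLaw_of_weakLiftingStatic_of_trop` — W_static ∧ TB ⇒ B (through the real static normal form
  `RealStatic.kPlusLogSqLaw_iff_staticSymm`), hence `kPlusLogSqLaw_iff_weakLiftingStatic_and_trop` — **B ⟺ W_static ∧ TB** (the static
  twin of the bridge `TropicalCensus.kPlusLogSqLaw_iff_weakLifting_and_trop`, p417903) and `weakLifting_iff_weakLiftingStatic_of_trop`
  (given TB, W ⟺ W_static);
* `valiant_of_trop_of_weakLiftingStatic` — TB → W_static → `VP ≠ VNP` over `ℂ` (the route's `closes`, with the static weak lift as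
  the second binder, through `Census.matrixDescartes_of_kPlusLogSqLaw` and `lacunarySymmetroid_assembly_proof`).  An implication with two
  OPEN hypotheses; VP ≠ VNP is NOT proved.
[folklore] bookkeeping on the cell's own statements; static reduction of parametric assignment (tree); Schur-complement linearisation (tree).
-/

set_option linter.dupNamespace false
set_option autoImplicit false

namespace Summit.ValiantsHypothesis.ValiantsHypothesis.Theorems.KPlusLogSqLaw.RealStatic

open Summit.ValiantsHypothesis.ValiantsHypothesis.Theorems.LacunarySymmetroidMatrixDescartes (RealRootLawAt KPlusLogSqLaw)
open Summit.ValiantsHypothesis.ValiantsHypothesis.Theorems.LacunarySymmetroidMatrixDescartes.Census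
  (realRootLawAt_mono matrixDescartes_of_kPlusLogSqLaw)
open Summit.ValiantsHypothesis.ValiantsHypothesis.Theorems.LacunarySymmetroidMatrixDescartes.TropicalCensus
  (TropRootLawAt TropRootLawAtStatic TropKPlusLogSqLaw realRootLawAt_zero tropRootLawAtStatic_of_tropRootLawAt
    tropRootLawAt_of_static tropKPlusLogSqLaw_of_kPlusLogSqLaw weakLifting_of_kPlusLogSqLaw)
open scoped BigOperators Matrix
open Polynomial

/-- **B ⇒ static weak LIFT**, with no tropical input (B bounds every real row outright). [folklore] -/
theorem weakLiftingStatic_of_kPlusLogSqLaw (h : KPlusLogSqLaw) :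
    ∃ C : ℕ, ∀ (m K n : ℕ), TropRootLawAtStatic m K n →
      ∀ (d : Fin K → ℕ) (E : Fin K → Matrix (Fin m) (Fin m) ℝ), (∀ l, (E l).IsSymm) →
        (∀ x y (l₁ l₂ : Fin K), E l₁ x y ≠ 0 → E l₂ x y ≠ 0 → l₁ = l₂) →
        (Matrix.det (∑ l, ((Polynomial.X : Polynomial ℝ) ^ d l) • (E l).map Polynomial.C)).roots.toFinset.card
          ≤ 2 ^ (C * (K + Nat.log 2 m ^ 2)) * (n + 1) := by
  obtain ⟨C, hC⟩ := h
  refine ⟨C, fun m K n _ d E hsy _ => (hC m K d E hsy).trans ?_⟩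
  exact Nat.le_mul_of_pos_right _ (Nat.succ_pos n)

/-- the static-reduction factor fits the budget: `m·m·(K−1) + 1 ≤ 2^(3·(K + ⌊log₂ m⌋²) + 2)`. [folklore] -/
theorem static_factor_le (m K : ℕ) : m * m * (K - 1) + 1 ≤ 2 ^ (3 * (K + Nat.log 2 m ^ 2) + 2) := by
  set L := Nat.log 2 m with hL
  have hm : m < 2 ^ (L + 1) := Nat.lt_pow_succ_log_self one_lt_two m
  have hK : K - 1 < 2 ^ K := lt_of_le_of_lt (Nat.sub_le K 1) (Nat.lt_two_pow_self)
  have h1 : m * m * (K - 1) < 2 ^ (L + 1) * 2 ^ (L + 1) * 2 ^ K := by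
    rcases Nat.eq_zero_or_pos (K - 1) with h0 | h0
    · rw [h0, mul_zero]; positivity
    rcases Nat.eq_zero_or_pos m with hm0 | hm0
    · rw [hm0]; simp
    exact Nat.mul_lt_mul'' (Nat.mul_lt_mul'' hm hm) hK
  have h2 : 2 ^ (L + 1) * 2 ^ (L + 1) * 2 ^ K = 2 ^ (2 * L + 2 + K) := by
    rw [← pow_add, ← pow_add]; congr 1; ring
  have h3 : 2 * L + 2 + K ≤ 3 * (K + L ^ 2) + 2 := by nlinarith
  have h4 : 2 ^ (2 * L + 2 + K) ≤ 2 ^ (3 * (K + L ^ 2) + 2) := Nat.pow_le_pow_right two_pos h3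
  omega

/-- **W ⇒ W_static, unconditionally.**  A static tropical row `T_static(m,K) ≤ n` gives the tropical row
`T(m,K) ≤ (m²(K−1)+1)(n+1) − 1` (`TropicalCensus.tropRootLawAt_of_static`), so weak LIFT bounds every real row — in particular every
static symmetric one — by `2^(C(K+L²))·(m²(K−1)+1)(n+1) ≤ 2^((C+5)(K+L²))·(n+1)` for `K ≥ 1`. [folklore] -/
theorem weakLiftingStatic_of_weakLifting
    (hW : ∃ C : ℕ, ∀ m K n : ℕ, TropRootLawAt m K n →
      RealRootLawAt m K (2 ^ (C * (K + Nat.log 2 m ^ 2)) * (n + 1))) :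
    ∃ C : ℕ, ∀ (m K n : ℕ), TropRootLawAtStatic m K n →
      ∀ (d : Fin K → ℕ) (E : Fin K → Matrix (Fin m) (Fin m) ℝ), (∀ l, (E l).IsSymm) →
        (∀ x y (l₁ l₂ : Fin K), E l₁ x y ≠ 0 → E l₂ x y ≠ 0 → l₁ = l₂) →
        (Matrix.det (∑ l, ((Polynomial.X : Polynomial ℝ) ^ d l) • (E l).map Polynomial.C)).roots.toFinset.card
          ≤ 2 ^ (C * (K + Nat.log 2 m ^ 2)) * (n + 1) := by
  obtain ⟨C, hC⟩ := hW
  refine ⟨C + 5, fun m K n hT d E hsy _ => ?_⟩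
  rcases Nat.eq_zero_or_pos K with rfl | hK
  · exact (realRootLawAt_zero m _ d E hsy)
  have h1 := hC m K _ (tropRootLawAt_of_static hT) d E hsy
  refine h1.trans ?_
  set L := Nat.log 2 m with hL
  have h2 : (m * m * (K - 1) + 1) * (n + 1) - 1 + 1 = (m * m * (K - 1) + 1) * (n + 1) := by
    have : 0 < (m * m * (K - 1) + 1) * (n + 1) := by positivity
    omega
  rw [h2, ← mul_assoc]
  refine Nat.mul_le_mul_right _ ?_
  calc 2 ^ (C * (K + L ^ 2)) * (m * m * (K - 1) + 1)
      ≤ 2 ^ (C * (K + L ^ 2)) * 2 ^ (3 * (K + L ^ 2) + 2) := Nat.mul_le_mul_left _ (static_factor_le m K)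
    _ = 2 ^ (C * (K + L ^ 2) + (3 * (K + L ^ 2) + 2)) := by rw [← pow_add]
    _ ≤ 2 ^ ((C + 5) * (K + L ^ 2)) := Nat.pow_le_pow_right two_pos (by nlinarith)

/-- **static weak LIFT ∧ TB ⇒ B**: TB bounds the static tropical rows (they are special tropical rows), the static weak lift turns
them into static symmetric real rows `2^(C(K+L²))·(2^(C'(K+L²)) + 1) ≤ 2^((C+C'+1)(K+L²))`, and the REAL STATIC NORMAL FORM
(`kPlusLogSqLaw_iff_staticSymm`) turns those into Conjecture B. [folklore] -/
theorem kPlusLogSqLaw_of_weakLiftingStatic_of_trop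
    (hW : ∃ C : ℕ, ∀ (m K n : ℕ), TropRootLawAtStatic m K n →
      ∀ (d : Fin K → ℕ) (E : Fin K → Matrix (Fin m) (Fin m) ℝ), (∀ l, (E l).IsSymm) →
        (∀ x y (l₁ l₂ : Fin K), E l₁ x y ≠ 0 → E l₂ x y ≠ 0 → l₁ = l₂) →
        (Matrix.det (∑ l, ((Polynomial.X : Polynomial ℝ) ^ d l) • (E l).map Polynomial.C)).roots.toFinset.card
          ≤ 2 ^ (C * (K + Nat.log 2 m ^ 2)) * (n + 1))
    (hT : TropKPlusLogSqLaw) : KPlusLogSqLaw := by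
  obtain ⟨C, hC⟩ := hW
  obtain ⟨C', hC'⟩ := hT
  rw [kPlusLogSqLaw_iff_staticSymm]
  refine ⟨C + C' + 1, fun m K d E hsy hst => ?_⟩
  rcases Nat.eq_zero_or_pos K with rfl | hK
  · exact (realRootLawAt_zero m _ d E hsy)
  have h := hC m K _ (tropRootLawAtStatic_of_tropRootLawAt (hC' m K)) d E hsy hst
  refine h.trans ?_
  have key : ∀ e : ℕ, 2 ^ e + 1 ≤ 2 ^ (e + 1) := fun e => by
    have := Nat.one_le_two_pow (n := e)
    rw [Nat.pow_succ]; omega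
  calc 2 ^ (C * (K + Nat.log 2 m ^ 2)) * (2 ^ (C' * (K + Nat.log 2 m ^ 2)) + 1)
      ≤ 2 ^ (C * (K + Nat.log 2 m ^ 2)) * 2 ^ (C' * (K + Nat.log 2 m ^ 2) + 1) := Nat.mul_le_mul_left _ (key _)
    _ = 2 ^ (C * (K + Nat.log 2 m ^ 2) + (C' * (K + Nat.log 2 m ^ 2) + 1)) := by rw [← pow_add]
    _ ≤ 2 ^ ((C + C' + 1) * (K + Nat.log 2 m ^ 2)) := by
        apply Nat.pow_le_pow_right two_pos
        nlinarith

/-- **B ⟺ (static weak LIFT ∧ TB)** — the static split of Conjecture B is lossless (static twin of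
`TropicalCensus.kPlusLogSqLaw_iff_weakLifting_and_trop`). [folklore] -/
theorem kPlusLogSqLaw_iff_weakLiftingStatic_and_trop :
    KPlusLogSqLaw ↔
      ((∃ C : ℕ, ∀ (m K n : ℕ), TropRootLawAtStatic m K n →
        ∀ (d : Fin K → ℕ) (E : Fin K → Matrix (Fin m) (Fin m) ℝ), (∀ l, (E l).IsSymm) →
          (∀ x y (l₁ l₂ : Fin K), E l₁ x y ≠ 0 → E l₂ x y ≠ 0 → l₁ = l₂) →
          (Matrix.det (∑ l, ((Polynomial.X : Polynomial ℝ) ^ d l) • (E l).map Polynomial.C)).roots.toFinset.card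
            ≤ 2 ^ (C * (K + Nat.log 2 m ^ 2)) * (n + 1)) ∧ TropKPlusLogSqLaw) :=
  ⟨fun h => ⟨weakLiftingStatic_of_kPlusLogSqLaw h, tropKPlusLogSqLaw_of_kPlusLogSqLaw h⟩,
    fun h => kPlusLogSqLaw_of_weakLiftingStatic_of_trop h.1 h.2⟩

/-- **given TB, weak LIFT ⟺ static weak LIFT** (both are then Conjecture B). [folklore] -/
theorem weakLifting_iff_weakLiftingStatic_of_trop (hT : TropKPlusLogSqLaw) :
    (∃ C : ℕ, ∀ m K n : ℕ, TropRootLawAt m K n →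
      RealRootLawAt m K (2 ^ (C * (K + Nat.log 2 m ^ 2)) * (n + 1))) ↔
    (∃ C : ℕ, ∀ (m K n : ℕ), TropRootLawAtStatic m K n →
      ∀ (d : Fin K → ℕ) (E : Fin K → Matrix (Fin m) (Fin m) ℝ), (∀ l, (E l).IsSymm) →
        (∀ x y (l₁ l₂ : Fin K), E l₁ x y ≠ 0 → E l₂ x y ≠ 0 → l₁ = l₂) →
        (Matrix.det (∑ l, ((Polynomial.X : Polynomial ℝ) ^ d l) • (E l).map Polynomial.C)).roots.toFinset.card
          ≤ 2 ^ (C * (K + Nat.log 2 m ^ 2)) * (n + 1)) :=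
  ⟨weakLiftingStatic_of_weakLifting,
    fun hW => weakLifting_of_kPlusLogSqLaw (kPlusLogSqLaw_of_weakLiftingStatic_of_trop hW hT)⟩

/-- **TB → static weak LIFT → VP ≠ VNP over ℂ** — the route's deciding composition with the STATIC weak lift as second binder:
Conjecture B by `kPlusLogSqLaw_of_weakLiftingStatic_of_trop`, then `Census.matrixDescartes_of_kPlusLogSqLaw` and the landed
`LacunarySymmetroid` assembly.  An implication with two OPEN hypotheses; nothing is asserted about VP ≠ VNP. [folklore] -/
theorem valiant_of_trop_of_weakLiftingStatic (hT : TropKPlusLogSqLaw)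
    (hW : ∃ C : ℕ, ∀ (m K n : ℕ), TropRootLawAtStatic m K n →
      ∀ (d : Fin K → ℕ) (E : Fin K → Matrix (Fin m) (Fin m) ℝ), (∀ l, (E l).IsSymm) →
        (∀ x y (l₁ l₂ : Fin K), E l₁ x y ≠ 0 → E l₂ x y ≠ 0 → l₁ = l₂) →
        (Matrix.det (∑ l, ((Polynomial.X : Polynomial ℝ) ^ d l) • (E l).map Polynomial.C)).roots.toFinset.card
          ≤ 2 ^ (C * (K + Nat.log 2 m ^ 2)) * (n + 1)) :
    _root_.ValiantsHypothesis :=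
  Summit.ValiantsHypothesis.ValiantsHypothesis.Theorems.lacunarySymmetroid_assembly_proof
    (matrixDescartes_of_kPlusLogSqLaw (kPlusLogSqLaw_of_weakLiftingStatic_of_trop hW hT))
    Summit.ValiantsHypothesis.ValiantsHypothesis.Theorems.LacunarySymmetroid.pencilTransfer_proof
    Summit.ValiantsHypothesis.ValiantsHypothesis.Theorems.LacunarySymmetroid.thetaWitness_proof

end Summit.ValiantsHypothesis.ValiantsHypothesis.Theorems.KPlusLogSqLaw.RealStatic
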